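import Summits.Ventures.YMGap.YM3IR.Clustering
import HarnessLib

/-!
# Coarse-graining geometry on the torus (`YM3IR/CoarseGeometry.lean`; cell `pub-ymgap`, track Y4,
ym3ir-theory-2)

HONEST FRAMING. Elementary, fully PROVED torus arithmetic for the block-label map `blockOf`
(`YM3IR/Clustering.lean`): the periodic sup-distance of two fine sites is at most `b` times the
periodic sup-distance of their blocks plus `b − 1` (`torusNorm_sub_le_blockOf`), and the resulting
separation bound for coarse sites near the blocks of separated fine sites
(`le_blockSeparation`) — the geometric input of the support statement `DecayTransfer` of
`YM3IR/Statement.lean` (coarse separation `≥ n/b − 2R − 1` of the coarse hulls of radius `R` of two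
fine sets at fine separation `≥ n`). Nothing model-specific; no axiom, no `sorry`. [folklore]
-/

namespace Summit.Ventures.YMGap.YM3IR

open Finset Literature.MathematicalPhysics.QuantumFieldTheory

variable {d : ℕ}

/-- Per coordinate: the periodic distance of `u, v ∈ ℤ/(bM)` is at most `b` times the periodic
distance of their block labels `⌊u/b⌋, ⌊v/b⌋ ∈ ℤ/M` plus `b − 1`. [folklore] -/
theorem natAbs_valMinAbs_sub_le_block {b M : ℕ} [NeZero M] (hb : 0 < b) (u v : ZMod (b * M)) :
    ((u - v).valMinAbs).natAbs ≤
      b * ((((u.val / b : ℕ) : ZMod M) - ((v.val / b : ℕ) : ZMod M)).valMinAbs).natAbs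
        + (b - 1) := by
  haveI : NeZero (b * M) := ⟨Nat.mul_ne_zero hb.ne' (NeZero.ne M)⟩
  -- Euclidean division of the canonical representatives by `b`
  set qu : ℕ := u.val / b with hqu
  set qv : ℕ := v.val / b with hqv
  set ru : ℕ := u.val % b with hru
  set rv : ℕ := v.val % b with hrv
  have hu : b * qu + ru = u.val := Nat.div_add_mod u.val b
  have hv : b * qv + rv = v.val := Nat.div_add_mod v.val b
  have hrub : ru < b := Nat.mod_lt _ hb
  have hrvb : rv < b := Nat.mod_lt _ hb
  -- the centred representative `c` of the block difference and the period multiple `k`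
  set c : ℤ := (((qu : ℕ) : ZMod M) - ((qv : ℕ) : ZMod M)).valMinAbs with hc_def
  have hc : (c : ZMod M) = ((qu : ℕ) : ZMod M) - ((qv : ℕ) : ZMod M) := ZMod.coe_valMinAbs _
  have hdvd : (M : ℤ) ∣ (qu : ℤ) - (qv : ℤ) - c := by
    rw [← ZMod.intCast_zmod_eq_zero_iff_dvd]
    simp only [Int.cast_sub, Int.cast_natCast, hc, sub_self]
  obtain ⟨k, hk⟩ := hdvd
  -- an integer representative of `u - v`
  set m : ℤ := (u.val : ℤ) - (v.val : ℤ) - k * (b : ℤ) * (M : ℤ) with hm_def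
  have hcast : ((m : ℤ) : ZMod (b * M)) = u - v := by
    simp only [hm_def, Int.cast_sub, Int.cast_mul, Int.cast_natCast, ZMod.natCast_zmod_val]
    rw [mul_assoc]
    have h0' : ((b : ℕ) : ZMod (b * M)) * ((M : ℕ) : ZMod (b * M)) = 0 := by
      rw [← Nat.cast_mul, ZMod.natCast_self]
    rw [h0', mul_zero, sub_zero]
  have hle : ((u - v).valMinAbs).natAbs ≤ m.natAbs := by
    rw [← hcast]
    exact natAbs_valMinAbs_intCast_le (b * M) m
  -- `m = b c + (ru - rv)`
  have hm : m = (b : ℤ) * c + ((ru : ℤ) - (rv : ℤ)) := by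
    have hu' : ((b : ℤ) * (qu : ℤ) + (ru : ℤ)) = (u.val : ℤ) := by exact_mod_cast hu
    have hv' : ((b : ℤ) * (qv : ℤ) + (rv : ℤ)) = (v.val : ℤ) := by exact_mod_cast hv
    rw [hm_def, ← hu', ← hv']
    linear_combination (b : ℤ) * hk
  have hr : ((ru : ℤ) - (rv : ℤ)).natAbs ≤ b - 1 := by omega
  calc ((u - v).valMinAbs).natAbs ≤ m.natAbs := hle
    _ = ((b : ℤ) * c + ((ru : ℤ) - (rv : ℤ))).natAbs := by rw [hm]
    _ ≤ ((b : ℤ) * c).natAbs + ((ru : ℤ) - (rv : ℤ)).natAbs := Int.natAbs_add_le _ _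
    _ = b * c.natAbs + ((ru : ℤ) - (rv : ℤ)).natAbs := by rw [Int.natAbs_mul, Int.natAbs_natCast]
    _ ≤ b * c.natAbs + (b - 1) := by omega

/-- **Fine distance versus block distance.** For fine sites `x, y` of the torus of side `b·M`,
`‖x − y‖_{∞, bM} ≤ b · ‖blockOf x − blockOf y‖_{∞, M} + (b − 1)`. [folklore] -/
theorem torusNorm_sub_le_blockOf {b M : ℕ} [NeZero M] (hb : 0 < b) (x y : Site d (b * M)) :
    torusNorm (x - y) ≤ b * torusNorm (blockOf b M x - blockOf b M y) + (b - 1) := by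
  refine Finset.sup_le fun i _ => ?_
  calc ((x - y) i).valMinAbs.natAbs = ((x i - y i).valMinAbs).natAbs := rfl
    _ ≤ b * (((((x i).val / b : ℕ) : ZMod M) - (((y i).val / b : ℕ) : ZMod M)).valMinAbs).natAbs
          + (b - 1) := natAbs_valMinAbs_sub_le_block hb (x i) (y i)
    _ = b * (((blockOf b M x - blockOf b M y) i).valMinAbs).natAbs + (b - 1) := rfl
    _ ≤ b * torusNorm (blockOf b M x - blockOf b M y) + (b - 1) := by
        gcongr
        exact natAbs_valMinAbs_le_torusNorm (blockOf b M x - blockOf b M y) i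

/-- **Block separation.** If fine sites `x, y` are at periodic sup-distance `≥ n` and coarse sites
`u, v` are within `R` of their blocks, then `n ≤ b · (‖u − v‖ + 2R) + (b − 1)`, i.e. the coarse
separation is at least `n/b − 2R − 1 + 1/b`. [folklore] -/
theorem le_blockSeparation {b M : ℕ} [NeZero M] (hb : 0 < b) {x y : Site d (b * M)}
    {u v : Site d M} {n R : ℕ} (hxy : n ≤ torusNorm (x - y))
    (hu : torusNorm (u - blockOf b M x) ≤ R) (hv : torusNorm (v - blockOf b M y) ≤ R) :
    n ≤ b * (torusNorm (u - v) + 2 * R) + (b - 1) := by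
  have h1 : torusNorm (blockOf b M x - blockOf b M y) ≤ torusNorm (u - v) + 2 * R := by
    have hux : torusNorm (blockOf b M x - u) ≤ R := by
      rw [← torusNorm_neg, neg_sub]; exact hu
    calc torusNorm (blockOf b M x - blockOf b M y)
        ≤ torusNorm (blockOf b M x - u) + torusNorm (u - blockOf b M y) := torusNorm_sub_le _ _ _
      _ ≤ torusNorm (blockOf b M x - u) + (torusNorm (u - v) + torusNorm (v - blockOf b M y)) :=
          by gcongr; exact torusNorm_sub_le _ _ _
      _ ≤ R + (torusNorm (u - v) + R) := by gcongr
      _ = torusNorm (u - v) + 2 * R := by ring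
  calc n ≤ torusNorm (x - y) := hxy
    _ ≤ b * torusNorm (blockOf b M x - blockOf b M y) + (b - 1) := torusNorm_sub_le_blockOf hb x y
    _ ≤ b * (torusNorm (u - v) + 2 * R) + (b - 1) := by gcongr

/-- Real-number form of `le_blockSeparation`: the coarse separation is at least
`n / b − 2R − 1`. [folklore] -/
theorem blockSeparation_ge {b M : ℕ} [NeZero M] (hb : 0 < b) {x y : Site d (b * M)}
    {u v : Site d M} {n R : ℕ} (hxy : n ≤ torusNorm (x - y))
    (hu : torusNorm (u - blockOf b M x) ≤ R) (hv : torusNorm (v - blockOf b M y) ≤ R) :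
    (n : ℝ) / b - 2 * R - 1 ≤ torusNorm (u - v) := by
  have h := le_blockSeparation hb hxy hu hv
  have hb' : (0 : ℝ) < b := by exact_mod_cast hb
  have hb1 : 1 ≤ b := hb
  have h' : (n : ℝ) ≤ b * (torusNorm (u - v) + 2 * R) + (b - 1) := by
    have := h
    zify [hb1] at this
    exact_mod_cast this
  rw [div_sub' (hc := hb'.ne'), div_sub' (hc := hb'.ne'), div_le_iff₀ hb']
  nlinarith

end Summit.Ventures.YMGap.YM3IR
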